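import Summits.HodgeConjecture.HodgeConjecture.Theorems.MarkmanPartnerTransportPartnerExistenceLattice
import Summits.HodgeConjecture.HodgeConjecture.Theorems.NikulinTwinTransportSquareTranscendental
import HarnessLib

/-!
# Route MarkmanPartnerTransport · support `PartnerExistence` (stmt-HodgeConjecture-19655) — Picard numbers of
# K3 partners: `ρ(S) = ρ(X) − 1` EXACTLY

Cell hodge-nonav, planner p1 g36 (09:43:06Z ∕ 09:48:21Z: «the PARTNER PICARD-RANK lemma»), prover seat 20241-p1
(g12). SUPPORT FILE (`--supports stmt-HodgeConjecture-19655`, helper): pure linear algebra on the tree's carriers;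
no named fact, no definition, no sorry; credits nothing.

For a smooth projective `K3^{[2]}`-type fourfold `X` marked by `φ : H²(X(ℂ); ℂ) ≅ ℂ²³` and a K3 PARTNER
`(S, η, p, g)` in the sense of item #9 `PartnerExistence` ∕ `exists_k3Partner_of_minusTwoClass` (X3a, 19716-p2 g4)
— `g : H²(S) → H²(X)` with (g6) «`g` maps `T(S) = N¹(S)^⊥` ONTO `T(X) = N¹(X)^⊥`» — the transcendental spaces
have `dim T(X) ≤ dim T(S)`, i.e. `23 − ρ(X) ≤ 22 − ρ(S)` (both forms are non-degenerate: `qC_nondegenerate`,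
`k3FormC_nondegenerate`, and `dim N^⊥ = dim H² − dim N`), so `ρ(S) + 1 ≤ ρ(X)`; with the converse inequality
`ρ(X) ≤ ρ(S) + 1` (the last clause of `exists_k3Partner_of_minusTwoClass`, from the injectivity of `g` on `T(S)`)
this is `ρ(S) + 1 = ρ(X)` EXACTLY:

* `finrank_algebraicClasses_succ_le_of_partner_onto` — `ρ(S) + 1 ≤ ρ(X)` from (g6) alone (minimal binders:
  the two markings' carriers, `p ≠ 0`, the cup-form clause of `S`, and (g6));
* `finrank_algebraicClasses_succ_eq_of_partner` — `ρ(S) + 1 = ρ(X)`, adding the inequality `ρ(X) ≤ ρ(S) + 1`;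
* `finrank_algebraicClasses_partner_eq_two_of_eq_three` — `ρ(X) = 3 ⇒ ρ(S) = 2` (the K3-side index of the
  crux `PicardThreeK3Squares` read on the fourfold side).

References: A. Beauville, J. Differential Geom. 18 (1983) §6 Prop. 6 (`b₂(S^{[2]}) = 23`); D. Huybrechts,
*Lectures on K3 Surfaces*, Ch. 1 §3.3, Ch. 3 Def. 2.5 and Lemma 3.1 (`T = NS^⊥`, non-degeneracy).
-/

noncomputable section

set_option linter.dupNamespace false

open Module CategoryTheory MonoidalCategory
open Literature.AlgebraicTopology.SingularHomology
open Literature.AlgebraicGeometry Literature.AlgebraicGeometry.Motives Literature.AlgebraicGeometry.HodgeTheory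
open Literature.AlgebraicGeometry.Hyperkaehler Literature.AlgebraicGeometry.Surfaces
open Summit.HodgeConjecture.HodgeConjecture.Theorems.NikulinTwinTransport

namespace Summit.HodgeConjecture.HodgeConjecture.Theorems.MarkmanPartnerTransport.PartnerLattice

variable {X S : SchemeOver ℂ}

/-- **`ρ(S) + 1 ≤ ρ(X)` for a K3 partner mapping `T(S)` onto `T(X)`** (clause (g6) of `PartnerExistence`):
`dim T(X) = 23 − ρ(X)` and `dim T(S) = 22 − ρ(S)` (orthogonal complements for the non-degenerate forms
`q ∘ φ` and `k3Form ∘ η`), and `T(X) ⊆ g(T(S))`. [cite: Huybrechts2016K3, Ch. 3 Def. 2.5 and Lemma 3.1]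
[cite: Beauville1983, §6 Prop. 6] -/
theorem finrank_algebraicClasses_succ_le_of_partner_onto
    (φ : complexBetti X 2 ≃ₗ[ℂ] (K3HilbertIndex → ℂ)) (η : complexBetti S (2 * 1) ≃ₗ[ℂ] (K3Index → ℂ))
    {p : complexBetti S (2 * 2)} (hp0 : p ≠ 0)
    (hηcup : ∀ a b : complexBetti S (2 * 1),
      cupProduct (rfl : 2 * 1 + 2 * 1 = 2 * 2) a b = k3Form (η a) (η b) • p)
    (g : complexBetti S (2 * 1) →ₗ[ℂ] complexBetti X 2)
    (hg6 : ∀ y : complexBetti X 2,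
      (∀ d : complexBetti X 2, d ∈ algebraicClasses X 1 → k3HilbertForm 2 (φ y) (φ d) = 0) →
        ∃ a : complexBetti S (2 * 1),
          (∀ d ∈ algebraicClasses S 1, cupProduct (rfl : 2 * 1 + 2 * 1 = 2 * 2) a d = 0) ∧ g a = y) :
    finrank ℂ (algebraicClasses S 1) + 1 ≤ finrank ℂ (algebraicClasses X 1) := by
  classical
  -- the two non-degenerate forms read through the markings
  set BX : LinearMap.BilinForm ℂ (complexBetti X 2) :=
    LinearMap.BilinForm.congr φ.symm (Matrix.toBilin' (Matrix.map (k3HilbertGram 2) (Int.cast : ℤ → ℂ)))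
    with hBXdef
  have hBX : ∀ y d, BX y d = k3HilbertForm 2 (φ y) (φ d) := fun y d ↦ by
    rw [hBXdef, LinearMap.BilinForm.congr_apply, LinearEquiv.symm_symm, qC_apply]
  have hBXnd : BX.Nondegenerate := qC_nondegenerate.congr φ.symm
  set BS : LinearMap.BilinForm ℂ (complexBetti S (2 * 1)) := LinearMap.BilinForm.congr η.symm k3FormC
    with hBSdef
  have hBS : ∀ a b, BS a b = k3Form (η a) (η b) := fun a b ↦ by
    rw [hBSdef, LinearMap.BilinForm.congr_apply, LinearEquiv.symm_symm, k3FormC_apply]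
  have hBSnd : BS.Nondegenerate := k3FormC_nondegenerate.congr η.symm
  -- the transcendental spaces and their dimensions
  have hX23 : finrank ℂ (complexBetti X 2) = 23 := φ.finrank_eq.trans finrank_complex23
  have hS22 : finrank ℂ (complexBetti S (2 * 1)) = 22 := by
    rw [η.finrank_eq, finrank_fintype_fun_eq_card]; rfl
  haveI : FiniteDimensional ℂ (complexBetti X 2) := Module.finite_of_finrank_eq_succ hX23
  haveI : FiniteDimensional ℂ (complexBetti S (2 * 1)) := Module.finite_of_finrank_eq_succ hS22
  have hTX : finrank ℂ (BX.orthogonal (algebraicClasses X 1)) = 23 - finrank ℂ (algebraicClasses X 1) := by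
    rw [LinearMap.BilinForm.finrank_orthogonal hBXnd, hX23]
  have hTS : finrank ℂ (BS.orthogonal (algebraicClasses S 1)) = 22 - finrank ℂ (algebraicClasses S 1) := by
    rw [LinearMap.BilinForm.finrank_orthogonal hBSnd, hS22]
  have hρX : finrank ℂ (algebraicClasses X 1) ≤ 23 := hX23 ▸ Submodule.finrank_le _
  have hρS : finrank ℂ (algebraicClasses S 1) ≤ 22 := hS22 ▸ Submodule.finrank_le _
  -- `T(X) ⊆ g(T(S))`
  have hle : BX.orthogonal (algebraicClasses X 1) ≤ (BS.orthogonal (algebraicClasses S 1)).map g := by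
    intro y hy
    rw [LinearMap.BilinForm.mem_orthogonal_iff] at hy
    obtain ⟨a, ha, rfl⟩ := hg6 y fun d hd ↦ by rw [k3HilbertForm_comm, ← hBX]; exact hy d hd
    refine Submodule.mem_map_of_mem ?_
    rw [LinearMap.BilinForm.mem_orthogonal_iff]
    intro d hd
    have h := ha d hd
    rw [hηcup, smul_eq_zero] at h
    rcases h with h | h
    · rw [hBS, k3Form_comm]; exact h
    · exact absurd h hp0
  have hfin : finrank ℂ (BX.orthogonal (algebraicClasses X 1)) ≤ finrank ℂ (BS.orthogonal (algebraicClasses S 1)) :=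
    (Submodule.finrank_mono hle).trans (Submodule.finrank_map_le _ _)
  rw [hTX, hTS] at hfin
  omega

/-- **`ρ(S) + 1 = ρ(X)` EXACTLY for a K3 partner** (planner p1 g36: «rank T(S) = rank T(X) ⇒ ρ(S) = ρ(X) − 1»):
the onto clause (g6) gives `ρ(S) + 1 ≤ ρ(X)` (`finrank_algebraicClasses_succ_le_of_partner_onto`), and the
injectivity of `g` on `T(S)` gives `ρ(X) ≤ ρ(S) + 1` (the last clause of `exists_k3Partner_of_minusTwoClass`,
taken here as the hypothesis `hle`). [cite: Huybrechts2016K3, Ch. 3 Def. 2.5 and Lemma 3.1]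
[cite: Beauville1983, §6 Prop. 6] -/
theorem finrank_algebraicClasses_succ_eq_of_partner
    (φ : complexBetti X 2 ≃ₗ[ℂ] (K3HilbertIndex → ℂ)) (η : complexBetti S (2 * 1) ≃ₗ[ℂ] (K3Index → ℂ))
    {p : complexBetti S (2 * 2)} (hp0 : p ≠ 0)
    (hηcup : ∀ a b : complexBetti S (2 * 1),
      cupProduct (rfl : 2 * 1 + 2 * 1 = 2 * 2) a b = k3Form (η a) (η b) • p)
    (g : complexBetti S (2 * 1) →ₗ[ℂ] complexBetti X 2)
    (hg6 : ∀ y : complexBetti X 2,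
      (∀ d : complexBetti X 2, d ∈ algebraicClasses X 1 → k3HilbertForm 2 (φ y) (φ d) = 0) →
        ∃ a : complexBetti S (2 * 1),
          (∀ d ∈ algebraicClasses S 1, cupProduct (rfl : 2 * 1 + 2 * 1 = 2 * 2) a d = 0) ∧ g a = y)
    (hle : finrank ℂ (algebraicClasses X 1) ≤ finrank ℂ (algebraicClasses S 1) + 1) :
    finrank ℂ (algebraicClasses S 1) + 1 = finrank ℂ (algebraicClasses X 1) :=
  le_antisymm (finrank_algebraicClasses_succ_le_of_partner_onto φ η hp0 hηcup g hg6) hle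

/-- **`ρ(X) = 3 ⇒ ρ(S) = 2`** for a K3 partner (the crux `PicardThreeK3Squares` index read on the fourfold
side). [cite: Huybrechts2016K3, Ch. 3 Def. 2.5] -/
theorem finrank_algebraicClasses_partner_eq_two_of_eq_three
    (φ : complexBetti X 2 ≃ₗ[ℂ] (K3HilbertIndex → ℂ)) (η : complexBetti S (2 * 1) ≃ₗ[ℂ] (K3Index → ℂ))
    {p : complexBetti S (2 * 2)} (hp0 : p ≠ 0)
    (hηcup : ∀ a b : complexBetti S (2 * 1),
      cupProduct (rfl : 2 * 1 + 2 * 1 = 2 * 2) a b = k3Form (η a) (η b) • p)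
    (g : complexBetti S (2 * 1) →ₗ[ℂ] complexBetti X 2)
    (hg6 : ∀ y : complexBetti X 2,
      (∀ d : complexBetti X 2, d ∈ algebraicClasses X 1 → k3HilbertForm 2 (φ y) (φ d) = 0) →
        ∃ a : complexBetti S (2 * 1),
          (∀ d ∈ algebraicClasses S 1, cupProduct (rfl : 2 * 1 + 2 * 1 = 2 * 2) a d = 0) ∧ g a = y)
    (hle : finrank ℂ (algebraicClasses X 1) ≤ finrank ℂ (algebraicClasses S 1) + 1)
    (h3 : finrank ℂ (algebraicClasses X 1) = 3) : finrank ℂ (algebraicClasses S 1) = 2 := by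
  have h := finrank_algebraicClasses_succ_eq_of_partner φ η hp0 hηcup g hg6 hle
  omega

end Summit.HodgeConjecture.HodgeConjecture.Theorems.MarkmanPartnerTransport.PartnerLattice

end
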